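import Summits.HodgeConjecture.CorCM.Census.OddSliceFacesGenerate
import Summits.HodgeConjecture.CorCM.Census.DicyclicTwistDescent

/-!
# The dicyclic twist `Dic(A) ⊃ ℤ/2 × A`, IV: the `2|A| + 2` residual functionals and their vanishing on pairs and on every reducing face

COR-CM (cell `pub-hodgecm2`, stage 2 of the Hodge ladder), count-neutral KERNEL COMBINATORICS by the binder seat b23 (gen 42; claim
DICYCLIC-COLUMN, HOME/INBOX.md l.10328): part IV of the lane `DicyclicTwistModel` → `DicyclicTwistFaces` → `DicyclicTwistDescent` →
`DicyclicTwistFunctionals` → `DicyclicTwistResidual` → `DicyclicTwistGenerate` → `DicyclicTwistCount`.  Bookkeeping definitions with bodies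
(`dft`, `lowI`, `uwt`, `U`, `U'`, `C₀`, `C₁`) + theorems on top of parts I–III and seat b09's class functional `Cfun`/`cwt`
(`Census/OddSliceFacesGenerate.lean`), used BY NAME; no `decide` table, no certificate, no named fact, no geometry, no `sorry`.
`Interfaces.lean` (C1), every E term, B01, `Transposition/*`, `PortJoin/*` untouched.
HONEST FRAMING: `HC_CM` is NOT proved, here or anywhere in the tree; nothing here is a period, a count of record or a headline.

CONTENT (`|A|` odd; dictionary of parts I–III).  The quotient of the Hodge lattice `H₂` by the pairs and ALL reducing faces is free of rank
`2|A| + 2` (design note `HOME/pub-hodgecm2-b23/DICYCLIC-COLUMN.md`, numerically certified for `|A| = 3, 5`); this file builds `2|A| + 2`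
`ℤ`-linear functionals on `ℤ[Ty₂ A]` that kill the pairs and every reducing face and — part V — detect the residual Hodge vectors:
* **`U s`** (`s ∈ A`), the dot product with `uwt s (a, b) = [a low]·[b up]·[b s = 0] − [a up]·[b low]·[b s = 1]` (`low` = weight `≤ |A|/2`,
  `up` = not low), and its mirror **`U' s`** (coordinates swapped);
* **`C₁ = Cfun ∘ marg₁`**, **`C₀ = Cfun ∘ marg₀`** (b09's signed-weight class functional on the two marginals).
WHY THEY VANISH (§2–§3): each weight is a sum of products `F(a)·G(b)` of functions AFFINE in the defect indicator on each half (`[· low]` is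
constant on a half; `b ↦ [b s = 1]` and `cwt` satisfy the square identity `G(φ) − G(φ^{(i)}) − G(φ^{(j)}) + G(φ^{(ij)}) = 0` for `i ≠ j`,
`dft_square`, `cwt_square`, the latter inside a half by the modularity of the weight `wt_square`), and each weight is ODD under conjugation
(`uwt_conj`, b09's `cwt_add_one`) — so the functional of a face class is the alternating sum over the square of unconjugated corners, which
vanishes for a coordinate square staying in a half and for a mixed square whose active flips stay in their halves: exactly the reducing faces of
part III (`U_redFace`, `U'_redFace`, `C₀_redFace`, `C₁_redFace`; `…_pairVec₂`).  Part VI evaluates them on the two closing squares, which CROSS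
the equator.  All [folklore].

## References
* [Pohlmann1968] H. Pohlmann, Algebraic cycles on abelian varieties of complex multiplication type, Ann. of Math. 88 (1968), Thm 1.
-/

namespace Summit.HodgeConjecture.CorCM.Census.DicyclicTwist

open Finset
open Summit.HodgeConjecture.CorCM.Census.OddSliceFacesModel
open Summit.HodgeConjecture.CorCM.Census.OddSliceFacesSquares
open Summit.HodgeConjecture.CorCM.Census.OddSliceFacesDescent
open Summit.HodgeConjecture.CorCM.Census.EvenSliceFacesDescent
open Summit.HodgeConjecture.CorCM.Census.OddSliceFacesGenerate

variable (A : Type) [AddCommGroup A] [Fintype A] [DecidableEq A]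

/-! ## §1 Affine quantities: the defect indicator, the half indicator, the signed weight -/

omit [AddCommGroup A] [Fintype A] in
/-- A flip at another place does not change the value at `i`. [folklore] -/
theorem add_delta_apply_ne {i j : A} (hij : i ≠ j) (φ : Ty A) : (φ + δ A j) i = φ i := by
  simp [delta_apply, hij]

omit [AddCommGroup A] in
/-- **Modularity of the weight**: `wt φ + wt φ^{(ij)} = wt φ^{(i)} + wt φ^{(j)}` for `i ≠ j`. [folklore] -/
theorem wt_square {φ : Ty A} {i j : A} (hij : i ≠ j) :
    wt A φ + wt A (φ + δ A i + δ A j) = wt A (φ + δ A i) + wt A (φ + δ A j) := by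
  have h01 : ∀ u : ZMod 2, u = 0 ∨ u = 1 := by decide
  have hji : (φ + δ A i) j = φ j := add_delta_apply_ne A (Ne.symm hij) φ
  rcases h01 (φ i) with hi | hi <;> rcases h01 (φ j) with hj | hj
  · rw [wt_add_delta_of_zero A (show (φ + δ A i) j = 0 by rw [hji]; exact hj), wt_add_delta_of_zero A hi,
      wt_add_delta_of_zero A hj]; omega
  · rw [wt_add_delta_of_apply_eq_one A (show (φ + δ A i) j = 1 by rw [hji]; exact hj), wt_add_delta_of_zero A hi,
      wt_add_delta_of_apply_eq_one A hj]
    have := wt_pos_of_one A hj; omega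
  · rw [wt_add_delta_of_zero A (show (φ + δ A i) j = 0 by rw [hji]; exact hj), wt_add_delta_of_apply_eq_one A hi,
      wt_add_delta_of_zero A hj]
    have := wt_pos_of_one A hi; omega
  · rw [wt_add_delta_of_apply_eq_one A (show (φ + δ A i) j = 1 by rw [hji]; exact hj), wt_add_delta_of_apply_eq_one A hi,
      wt_add_delta_of_apply_eq_one A hj]
    have h2 : 2 ≤ wt A φ := by
      unfold wt; exact Finset.one_lt_card_iff.mpr ⟨i, j, by simp [hi], by simp [hj], hij⟩
    omega

omit [AddCommGroup A] in
/-- **The signed weight is affine inside a half**: for `i ≠ j` and the three flipped corners in the half of `φ`,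
`cwt φ − cwt φ^{(i)} − cwt φ^{(j)} + cwt φ^{(ij)} = 0`. [folklore] -/
theorem cwt_square {φ : Ty A} {i j : A} (hij : i ≠ j) (h1 : (wt A (φ + δ A i) ≤ Fintype.card A / 2) ↔ (wt A φ ≤ Fintype.card A / 2)) (h2 : (wt A (φ + δ A j) ≤ Fintype.card A / 2) ↔ (wt A φ ≤ Fintype.card A / 2))
    (h3 : (wt A (φ + δ A i + δ A j) ≤ Fintype.card A / 2) ↔ (wt A φ ≤ Fintype.card A / 2)) :
    cwt A φ - cwt A (φ + δ A i) - cwt A (φ + δ A j) + cwt A (φ + δ A i + δ A j) = 0 := by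
  have hsq := wt_square A hij (φ := φ)
  unfold cwt
  by_cases hl : wt A φ ≤ Fintype.card A / 2
  · rw [if_pos hl, if_pos (h1.mpr hl), if_pos (h2.mpr hl), if_pos (h3.mpr hl)]; omega
  · rw [if_neg hl, if_neg (fun h => hl (h1.mp h)), if_neg (fun h => hl (h2.mp h)), if_neg (fun h => hl (h3.mp h))]; omega

/-- The defect indicator at the place `s`: `[φ s = 1]`. [folklore] -/
def dft (s : A) (φ : Ty A) : ℤ := if φ s = 1 then 1 else 0

omit [AddCommGroup A] [Fintype A] in
/-- **The defect indicator is affine**: `dft φ − dft φ^{(i)} − dft φ^{(j)} + dft φ^{(ij)} = 0` for `i ≠ j`. [folklore] -/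
theorem dft_square (s : A) {φ : Ty A} {i j : A} (hij : i ≠ j) :
    dft A s φ - dft A s (φ + δ A i) - dft A s (φ + δ A j) + dft A s (φ + δ A i + δ A j) = 0 := by
  unfold dft
  by_cases hsi : s = i
  · subst hsi
    rw [add_delta_apply_ne A hij φ, add_delta_apply_ne A hij (φ + δ A s)]; ring
  · have e2 : (φ + δ A i + δ A j) s = (φ + δ A j) s := by rw [add_right_comm]; exact add_delta_apply_ne A hsi _
    rw [add_delta_apply_ne A hsi φ, e2]; ring

omit [Fintype A] [AddCommGroup A] [DecidableEq A] in
/-- The defect indicator of the conjugate: `dft (φ + 1) = 1 − dft φ`. [folklore] -/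
theorem dft_add_one (s : A) (φ : Ty A) : dft A s (φ + 1) = 1 - dft A s φ := by
  unfold dft
  have key : ∀ u : ZMod 2, (if u + 1 = 1 then (1 : ℤ) else 0) = 1 - (if u = 1 then (1 : ℤ) else 0) := by decide
  exact key (φ s)

/-- The half indicator `[φ low] = [wt φ ≤ |A|/2]`. [folklore] -/
def lowI (φ : Ty A) : ℤ := if (wt A φ ≤ Fintype.card A / 2) then 1 else 0

omit [DecidableEq A] [AddCommGroup A] in
/-- Conjugation swaps the halves (`|A|` odd): `[φ̄ low] = 1 − [φ low]`. [folklore] -/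
theorem lowI_add_one (hA : Odd (Fintype.card A)) (φ : Ty A) : lowI A (φ + 1) = 1 - lowI A φ := by
  unfold lowI
  by_cases h : wt A φ ≤ Fintype.card A / 2
  · rw [if_pos h, if_neg (not_wt_add_one_le A hA h)]; ring
  · rw [if_neg h, if_pos (wt_add_one_le A hA h)]; ring

omit [DecidableEq A] [AddCommGroup A] in
/-- Labels in the same half have the same half indicator. [folklore] -/
theorem lowI_congr {φ χ : Ty A} (h : (wt A φ ≤ Fintype.card A / 2) ↔ (wt A χ ≤ Fintype.card A / 2)) : lowI A φ = lowI A χ := by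
  unfold lowI
  by_cases hχ : (wt A χ ≤ Fintype.card A / 2)
  · rw [if_pos hχ, if_pos (h.mpr hχ)]
  · rw [if_neg hχ, if_neg (fun h' => hχ (h.mp h'))]

/-! ## §2 The functionals `U s`, `U' s` -/

/-- The weight of `U s`: `[a low][b up][b s = 0] − [a up][b low][b s = 1]`. [folklore] -/
def uwt (s : A) (Ψ : Ty₂ A) : ℤ :=
  lowI A Ψ.1 * (1 - lowI A Ψ.2) * (1 - dft A s Ψ.2) - (1 - lowI A Ψ.1) * lowI A Ψ.2 * dft A s Ψ.2

/-- **The functional `U s`** (`s ∈ A`): the dot product with `uwt s`. [folklore] -/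
def U (s : A) : (Ty₂ A → ℤ) →ₗ[ℤ] ℤ where
  toFun v := uwt A s ⬝ᵥ v
  map_add' v w := dotProduct_add _ _ _
  map_smul' c v := by
    show uwt A s ⬝ᵥ (c • v) = c • (uwt A s ⬝ᵥ v)
    exact dotProduct_smul c _ v

/-- **The mirror functional `U' s`**: `U s` with the two coordinates swapped. [folklore] -/
def U' (s : A) : (Ty₂ A → ℤ) →ₗ[ℤ] ℤ where
  toFun v := (fun Ψ : Ty₂ A => uwt A s (Ψ.2, Ψ.1)) ⬝ᵥ v
  map_add' v w := dotProduct_add _ _ _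
  map_smul' c v := by
    show (fun Ψ : Ty₂ A => uwt A s (Ψ.2, Ψ.1)) ⬝ᵥ (c • v) = c • ((fun Ψ : Ty₂ A => uwt A s (Ψ.2, Ψ.1)) ⬝ᵥ v)
    exact dotProduct_smul c _ v

omit [AddCommGroup A] in
/-- `U s` on a unit vector. [folklore] -/
@[simp] theorem U_single (s : A) (Ψ : Ty₂ A) (c : ℤ) : U A s (Pi.single Ψ c) = uwt A s Ψ * c := by
  show uwt A s ⬝ᵥ Pi.single Ψ c = _; rw [dotProduct_single]

omit [AddCommGroup A] in
/-- `U' s` on a unit vector. [folklore] -/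
@[simp] theorem U'_single (s : A) (Ψ : Ty₂ A) (c : ℤ) : U' A s (Pi.single Ψ c) = uwt A s (Ψ.2, Ψ.1) * c := by
  show (fun Ψ : Ty₂ A => uwt A s (Ψ.2, Ψ.1)) ⬝ᵥ Pi.single Ψ c = _; rw [dotProduct_single]

omit [AddCommGroup A] [DecidableEq A] in
/-- **The weight is odd under conjugation** (`|A|` odd). [folklore] -/
theorem uwt_conj (hA : Odd (Fintype.card A)) (s : A) (a b : Ty A) : uwt A s (a + 1, b + 1) = -uwt A s (a, b) := by
  unfold uwt
  simp only [lowI_add_one A hA, dft_add_one]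
  ring

omit [DecidableEq A] [AddCommGroup A] in
/-- The weight depends on the first coordinate only through its half. [folklore] -/
theorem uwt_fst_congr (s : A) {a a' : Ty A} (h : (wt A a ≤ Fintype.card A / 2) ↔ (wt A a' ≤ Fintype.card A / 2)) (b : Ty A) : uwt A s (a, b) = uwt A s (a', b) := by
  unfold uwt; simp only [lowI_congr A h]

omit [AddCommGroup A] in
/-- **The weight is affine in the second coordinate inside a half.** [folklore] -/
theorem uwt_snd_square (s : A) (a : Ty A) {φ : Ty A} {i j : A} (hij : i ≠ j) (h1 : (wt A (φ + δ A i) ≤ Fintype.card A / 2) ↔ (wt A φ ≤ Fintype.card A / 2))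
    (h2 : (wt A (φ + δ A j) ≤ Fintype.card A / 2) ↔ (wt A φ ≤ Fintype.card A / 2)) (h3 : (wt A (φ + δ A i + δ A j) ≤ Fintype.card A / 2) ↔ (wt A φ ≤ Fintype.card A / 2)) :
    uwt A s (a, φ) - uwt A s (a, φ + δ A i) - uwt A s (a, φ + δ A j) + uwt A s (a, φ + δ A i + δ A j) = 0 := by
  have hd := dft_square A s hij (φ := φ)
  have hd' : dft A s (φ + δ A i + δ A j) = dft A s (φ + δ A i) + dft A s (φ + δ A j) - dft A s φ := by omega
  unfold uwt
  simp only [lowI_congr A h1, lowI_congr A h2, lowI_congr A h3]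
  rw [hd']; ring

omit [AddCommGroup A] in
/-- `U s` kills the pairs. [folklore] -/
theorem U_pairVec₂ (hA : Odd (Fintype.card A)) (s : A) (Ψ : Ty₂ A) : U A s (pairVec₂ A Ψ) = 0 := by
  obtain ⟨a, b⟩ := Ψ
  rw [pairVec₂, map_add, U_single, U_single]
  show uwt A s (a, b) * 1 + uwt A s (a + 1, b + 1) * 1 = 0
  rw [uwt_conj A hA]; ring

omit [AddCommGroup A] in
/-- `U' s` kills the pairs. [folklore] -/
theorem U'_pairVec₂ (hA : Odd (Fintype.card A)) (s : A) (Ψ : Ty₂ A) : U' A s (pairVec₂ A Ψ) = 0 := by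
  obtain ⟨a, b⟩ := Ψ
  rw [pairVec₂, map_add, U'_single, U'_single]
  show uwt A s (b, a) * 1 + uwt A s (b + 1, a + 1) * 1 = 0
  rw [uwt_conj A hA]; ring

omit [AddCommGroup A] in
/-- `U s` of a `0`-coordinate square whose active flips stay in a half vanishes. [folklore] -/
theorem U_faceVec₀ (hA : Odd (Fintype.card A)) (s : A) {φ : Ty A} {i j : A} (ψ : Ty A) (h1 : (wt A (φ + δ A i) ≤ Fintype.card A / 2) ↔ (wt A φ ≤ Fintype.card A / 2))
    (h2 : (wt A (φ + δ A j) ≤ Fintype.card A / 2) ↔ (wt A φ ≤ Fintype.card A / 2)) (h3 : (wt A (φ + δ A i + δ A j) ≤ Fintype.card A / 2) ↔ (wt A φ ≤ Fintype.card A / 2)) :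
    U A s (faceVec₀ A φ i j ψ) = 0 := by
  rw [faceVec₀, map_add, map_add, map_add, U_single, U_single, U_single, U_single, add_right_comm φ 1 (δ A i),
    add_right_comm φ 1 (δ A j), uwt_conj A hA, uwt_conj A hA, uwt_fst_congr A s h1, uwt_fst_congr A s h2, uwt_fst_congr A s h3]
  ring

omit [AddCommGroup A] in
/-- `U s` of a `1`-coordinate square whose active flips stay in a half vanishes. [folklore] -/
theorem U_faceVec₁ (hA : Odd (Fintype.card A)) (s : A) (ψ : Ty A) {φ : Ty A} {i j : A} (hij : i ≠ j)
    (h1 : (wt A (φ + δ A i) ≤ Fintype.card A / 2) ↔ (wt A φ ≤ Fintype.card A / 2)) (h2 : (wt A (φ + δ A j) ≤ Fintype.card A / 2) ↔ (wt A φ ≤ Fintype.card A / 2)) (h3 : (wt A (φ + δ A i + δ A j) ≤ Fintype.card A / 2) ↔ (wt A φ ≤ Fintype.card A / 2)) :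
    U A s (faceVec₁ A ψ φ i j) = 0 := by
  have hsq := uwt_snd_square A s ψ hij h1 h2 h3
  rw [faceVec₁, map_add, map_add, map_add, U_single, U_single, U_single, U_single, add_right_comm φ 1 (δ A i),
    add_right_comm φ 1 (δ A j), uwt_conj A hA, uwt_conj A hA]
  omega

omit [AddCommGroup A] in
/-- `U s` of a mixed square whose `0`-coordinate flip stays in a half vanishes. [folklore] -/
theorem U_faceVecM (hA : Odd (Fintype.card A)) (s : A) {φ : Ty A} {i : A} (ψ : Ty A) (j : A) (h1 : (wt A (φ + δ A i) ≤ Fintype.card A / 2) ↔ (wt A φ ≤ Fintype.card A / 2)) :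
    U A s (faceVecM A φ i ψ j) = 0 := by
  rw [faceVecM, map_add, map_add, map_add, U_single, U_single, U_single, U_single, add_right_comm φ 1 (δ A i),
    add_right_comm ψ 1 (δ A j), uwt_conj A hA, uwt_conj A hA, uwt_fst_congr A s h1 ψ, uwt_fst_congr A s h1 (ψ + δ A j)]
  ring

omit [AddCommGroup A] in
/-- `U' s` of a `1`-coordinate square whose active flips stay in a half vanishes. [folklore] -/
theorem U'_faceVec₁ (hA : Odd (Fintype.card A)) (s : A) (ψ : Ty A) {φ : Ty A} {i j : A} (h1 : (wt A (φ + δ A i) ≤ Fintype.card A / 2) ↔ (wt A φ ≤ Fintype.card A / 2))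
    (h2 : (wt A (φ + δ A j) ≤ Fintype.card A / 2) ↔ (wt A φ ≤ Fintype.card A / 2)) (h3 : (wt A (φ + δ A i + δ A j) ≤ Fintype.card A / 2) ↔ (wt A φ ≤ Fintype.card A / 2)) :
    U' A s (faceVec₁ A ψ φ i j) = 0 := by
  rw [faceVec₁, map_add, map_add, map_add, U'_single, U'_single, U'_single, U'_single]
  simp only
  rw [add_right_comm φ 1 (δ A i), add_right_comm φ 1 (δ A j), uwt_conj A hA, uwt_conj A hA, uwt_fst_congr A s h1,
    uwt_fst_congr A s h2, uwt_fst_congr A s h3]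
  ring

omit [AddCommGroup A] in
/-- `U' s` of a `0`-coordinate square whose active flips stay in a half vanishes. [folklore] -/
theorem U'_faceVec₀ (hA : Odd (Fintype.card A)) (s : A) {φ : Ty A} {i j : A} (ψ : Ty A) (hij : i ≠ j)
    (h1 : (wt A (φ + δ A i) ≤ Fintype.card A / 2) ↔ (wt A φ ≤ Fintype.card A / 2)) (h2 : (wt A (φ + δ A j) ≤ Fintype.card A / 2) ↔ (wt A φ ≤ Fintype.card A / 2)) (h3 : (wt A (φ + δ A i + δ A j) ≤ Fintype.card A / 2) ↔ (wt A φ ≤ Fintype.card A / 2)) :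
    U' A s (faceVec₀ A φ i j ψ) = 0 := by
  have hsq := uwt_snd_square A s ψ hij h1 h2 h3
  rw [faceVec₀, map_add, map_add, map_add, U'_single, U'_single, U'_single, U'_single]
  simp only
  rw [add_right_comm φ 1 (δ A i), add_right_comm φ 1 (δ A j), uwt_conj A hA, uwt_conj A hA]
  omega

omit [AddCommGroup A] in
/-- `U' s` of a mixed square whose `1`-coordinate flip stays in a half vanishes. [folklore] -/
theorem U'_faceVecM (hA : Odd (Fintype.card A)) (s : A) (φ : Ty A) (i : A) {ψ : Ty A} {j : A} (h1 : (wt A (ψ + δ A j) ≤ Fintype.card A / 2) ↔ (wt A ψ ≤ Fintype.card A / 2)) :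
    U' A s (faceVecM A φ i ψ j) = 0 := by
  rw [faceVecM, map_add, map_add, map_add, U'_single, U'_single, U'_single, U'_single]
  simp only
  rw [add_right_comm φ 1 (δ A i), add_right_comm ψ 1 (δ A j), uwt_conj A hA, uwt_conj A hA, uwt_fst_congr A s h1 φ,
    uwt_fst_congr A s h1 (φ + δ A i)]
  ring

/-- **`U s` kills every reducing face.** [folklore] -/
theorem U_redFace (hA : Odd (Fintype.card A)) (s : A) {Ψ : Ty₂ A} (h : 2 ≤ pot A Ψ) : U A s (redFace A Ψ) = 0 := by
  obtain ⟨ψ₀, ψ₁⟩ := Ψ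
  have hp : pot A (ψ₀, ψ₁) = clsTy A ψ₀ + clsTy A ψ₁ := rfl
  by_cases h0 : 2 ≤ clsTy A ψ₀
  · obtain ⟨eP, eF⟩ := redFace_eq₀ A (ψ₁ := ψ₁) h0
    obtain ⟨-, -, -, -, l1, l2, l3⟩ := (exists_two_reducing A h0).choose_spec
    rw [eF, eP]; exact U_faceVec₀ A hA s ψ₁ l1 l2 l3
  · by_cases h1 : 2 ≤ clsTy A ψ₁
    · obtain ⟨eP, eF⟩ := redFace_eq₁ A h0 h1
      obtain ⟨hij, -, -, -, l1, l2, l3⟩ := (exists_two_reducing A h1).choose_spec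
      rw [eF, eP]; exact U_faceVec₁ A hA s ψ₀ hij l1 l2 l3
    · have h2 : clsTy A ψ₀ = 1 ∧ clsTy A ψ₁ = 1 := by rw [hp] at h; omega
      obtain ⟨eP, eF⟩ := redFace_eqM A h0 h1 h2
      rw [eF, eP]; exact U_faceVecM A hA s ψ₁ _ (exists_one_reducing A h2.1).choose_spec.2

/-- **`U' s` kills every reducing face.** [folklore] -/
theorem U'_redFace (hA : Odd (Fintype.card A)) (s : A) {Ψ : Ty₂ A} (h : 2 ≤ pot A Ψ) : U' A s (redFace A Ψ) = 0 := by
  obtain ⟨ψ₀, ψ₁⟩ := Ψ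
  have hp : pot A (ψ₀, ψ₁) = clsTy A ψ₀ + clsTy A ψ₁ := rfl
  by_cases h0 : 2 ≤ clsTy A ψ₀
  · obtain ⟨eP, eF⟩ := redFace_eq₀ A (ψ₁ := ψ₁) h0
    obtain ⟨hij, -, -, -, l1, l2, l3⟩ := (exists_two_reducing A h0).choose_spec
    rw [eF, eP]; exact U'_faceVec₀ A hA s ψ₁ hij l1 l2 l3
  · by_cases h1 : 2 ≤ clsTy A ψ₁
    · obtain ⟨eP, eF⟩ := redFace_eq₁ A h0 h1
      obtain ⟨-, -, -, -, l1, l2, l3⟩ := (exists_two_reducing A h1).choose_spec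
      rw [eF, eP]; exact U'_faceVec₁ A hA s ψ₀ l1 l2 l3
    · have h2 : clsTy A ψ₀ = 1 ∧ clsTy A ψ₁ = 1 := by rw [hp] at h; omega
      obtain ⟨eP, eF⟩ := redFace_eqM A h0 h1 h2
      rw [eF, eP]; exact U'_faceVecM A hA s ψ₀ _ (exists_one_reducing A h2.2).choose_spec.2

/-! ## §3 The class functionals of the marginals `C₀`, `C₁` -/

/-- **`C₀ = Cfun ∘ marg₀`**: b09's class functional of the `0`-marginal. [folklore] -/
noncomputable def C₀ : (Ty₂ A → ℤ) →ₗ[ℤ] ℤ := (Cfun A).comp (marg₀ A)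

/-- **`C₁ = Cfun ∘ marg₁`**: b09's class functional of the `1`-marginal. [folklore] -/
noncomputable def C₁ : (Ty₂ A → ℤ) →ₗ[ℤ] ℤ := (Cfun A).comp (marg₁ A)

omit [AddCommGroup A] in
/-- `C₀ v = Cfun (marg₀ v)`. [folklore] -/
@[simp] theorem C₀_apply (v : Ty₂ A → ℤ) : C₀ A v = Cfun A (marg₀ A v) := rfl

omit [AddCommGroup A] in
/-- `C₁ v = Cfun (marg₁ v)`. [folklore] -/
@[simp] theorem C₁_apply (v : Ty₂ A → ℤ) : C₁ A v = Cfun A (marg₁ A v) := rfl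

omit [AddCommGroup A] in
/-- `Cfun` of b09's face class is the alternating signed-weight sum over the unconjugated corners (`|A|` odd). [folklore] -/
theorem Cfun_faceVec_eq (hA : Odd (Fintype.card A)) (φ : Ty A) (i j : A) :
    Cfun A (faceVec A φ i j) = cwt A φ - cwt A (φ + δ A i) - cwt A (φ + δ A j) + cwt A (φ + δ A i + δ A j) := by
  rw [Cfun_faceVec, add_right_comm φ 1 (δ A i), add_right_comm φ 1 (δ A j), cwt_add_one A hA, cwt_add_one A hA]
  ring

omit [AddCommGroup A] in
/-- `C₁` kills the pairs. [folklore] -/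
theorem C₁_pairVec₂ (hA : Odd (Fintype.card A)) (Ψ : Ty₂ A) : C₁ A (pairVec₂ A Ψ) = 0 := by
  rw [C₁_apply, marg₁_pairVec₂, Cfun_pairVec A hA]

omit [AddCommGroup A] in
/-- `C₀` kills the pairs. [folklore] -/
theorem C₀_pairVec₂ (hA : Odd (Fintype.card A)) (Ψ : Ty₂ A) : C₀ A (pairVec₂ A Ψ) = 0 := by
  rw [C₀_apply, marg₀_pairVec₂, Cfun_pairVec A hA]

omit [AddCommGroup A] in
/-- `Cfun` kills twice a pair. [folklore] -/
theorem Cfun_two_smul_pairVec (hA : Odd (Fintype.card A)) (ψ : Ty A) : Cfun A (2 • pairVec A ψ) = 0 := by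
  rw [map_nsmul, Cfun_pairVec A hA, smul_zero]

/-- **`C₁` kills every reducing face.** [folklore] -/
theorem C₁_redFace (hA : Odd (Fintype.card A)) {Ψ : Ty₂ A} (h : 2 ≤ pot A Ψ) : C₁ A (redFace A Ψ) = 0 := by
  obtain ⟨ψ₀, ψ₁⟩ := Ψ
  have hp : pot A (ψ₀, ψ₁) = clsTy A ψ₀ + clsTy A ψ₁ := rfl
  by_cases h0 : 2 ≤ clsTy A ψ₀
  · obtain ⟨eP, eF⟩ := redFace_eq₀ A (ψ₁ := ψ₁) h0
    rw [eF, C₁_apply, marg₁_faceVec₀, Cfun_two_smul_pairVec A hA]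
  · by_cases h1 : 2 ≤ clsTy A ψ₁
    · obtain ⟨eP, eF⟩ := redFace_eq₁ A h0 h1
      obtain ⟨hij, -, -, -, l1, l2, l3⟩ := (exists_two_reducing A h1).choose_spec
      rw [eF, eP, C₁_apply, marg₁_faceVec₁, Cfun_faceVec_eq A hA]
      exact cwt_square A hij l1 l2 l3
    · have h2 : clsTy A ψ₀ = 1 ∧ clsTy A ψ₁ = 1 := by rw [hp] at h; omega
      obtain ⟨eP, eF⟩ := redFace_eqM A h0 h1 h2
      rw [eF, C₁_apply, marg₁_faceVecM, map_add, Cfun_pairVec A hA, Cfun_pairVec A hA, add_zero]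

/-- **`C₀` kills every reducing face.** [folklore] -/
theorem C₀_redFace (hA : Odd (Fintype.card A)) {Ψ : Ty₂ A} (h : 2 ≤ pot A Ψ) : C₀ A (redFace A Ψ) = 0 := by
  obtain ⟨ψ₀, ψ₁⟩ := Ψ
  have hp : pot A (ψ₀, ψ₁) = clsTy A ψ₀ + clsTy A ψ₁ := rfl
  by_cases h0 : 2 ≤ clsTy A ψ₀
  · obtain ⟨eP, eF⟩ := redFace_eq₀ A (ψ₁ := ψ₁) h0
    obtain ⟨hij, -, -, -, l1, l2, l3⟩ := (exists_two_reducing A h0).choose_spec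
    rw [eF, eP, C₀_apply, marg₀_faceVec₀, Cfun_faceVec_eq A hA]
    exact cwt_square A hij l1 l2 l3
  · by_cases h1 : 2 ≤ clsTy A ψ₁
    · obtain ⟨eP, eF⟩ := redFace_eq₁ A h0 h1
      rw [eF, C₀_apply, marg₀_faceVec₁, Cfun_two_smul_pairVec A hA]
    · have h2 : clsTy A ψ₀ = 1 ∧ clsTy A ψ₁ = 1 := by rw [hp] at h; omega
      obtain ⟨eP, eF⟩ := redFace_eqM A h0 h1 h2
      rw [eF, C₀_apply, marg₀_faceVecM, map_add, Cfun_pairVec A hA, Cfun_pairVec A hA, add_zero]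

end Summit.HodgeConjecture.CorCM.Census.DicyclicTwist
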